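import Summits.QuantumFields.YangMills.Theorems.UnitScaleTiltHalvingP1FlatCoreTopH42Gamma
import Summits.QuantumFields.YangMills.Theorems.UnitScaleTiltHalvingHSiteTopRowsOfSocketsGamma
import HarnessLib

/-!
# Line H (`BirthV10.stub_halvingStep`, stmt-QuantumFields-19200) — ROAD γ (★★OWNER RULING g28-№11; LEAD-H WORD 25, V7-8γ ruled), FILE «H42-WRAP-γ» 1∕2:
# ★★★ THE RESHAPED `H42` SOCKET's INHABITANT IN EDITION γ — ✓`P1FlatCoreTopH42Gamma.H42_top_guarded_γ` (ym-ust-20520-w3 g8, p680361) AT THE PER-SITE COMPOSERS' LETTERS,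
# conclusion on print's split class `cubeLamBP′`, the level-`k` COLLAR residual `H42cross` displayed (∀(u, V′, A′)-closed), everything else as ✓`H42_of_towerTop` (p666867)

Cell `ym3-torus` (HUMAN RULING D-0037: YM₃ on T³ is ladder rung R3 — NOT d = 4, NOT a mass gap, NOT the Clay problem), width seat `ym-ust-19200-w7` gen 6 (twin of ym-ust-20520-w3 g7's
✓`HalvingHSiteTopH42OfTower`).  `--supports stmt-QuantumFields-19200 --as helper`; THEOREMS ONLY (0 `def`, 0 `sorry`); count-neutral; nothing here claims `hMember`, `hSupUρ4`, a
displayed socket, the stub, the crux or the gap.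

THE POINT.  The γ size-row supplier ✓`HalvingHSiteSizeRowsOfTopRowsGamma.siteSizeRows_of_topRows_γ` (T4γ) reads its `H42` socket on `Λb := cubeLamBP′ L a M′ ρ′ k` (inner bonds AND
the bonds sticking out of `□_j^{(j)}`, box law «box ⊂ □_{j−1}»).  ✓`H42_top_guarded_γ` inhabits it: levels `j < k` by lit ✓`B8Eq142KLevelLocalGamma.H42_of_inAx_γ` from (1.35) under
the γ law, the INNER top class `ΛbIn := cubeLamB … k k k` by the linear knit (ε₁-route of record: reads `hWf1`, budget `htop`), and the level-`k` COLLAR bonds `Λb k ∖ ΛbIn` by the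
displayed residual `H42cross` (LEAD-H WORD 25: «(1.42) on the level-k collar bonds of print's class — A6-witnessed at `A′ = 0` (✓`hcross_trivial_datum`); the estimate is OPEN»).
★★★ `H42_of_towerTop_γ` = ✓`H42_of_towerTop`'s displayed text with (i) the five [3]-windows in the γ shape `(L²ε₀, L·α₂)`, (ii) `H42cross` inserted after `htop` (at the knit
`Lan k W := IsLandau138W … W ∧ <W = (U♯)^{g′} ∘ π on the comb boxes of ΛbIn>`), (iii) the conclusion on `cubeLamBP′ … j`.  Discharged inside: `hΩ` (lit ✓`hΩ_cubeFam`), the γ box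
law (lit ✓`cubeLamBP'_hbox_pred`), the trichotomy below the top (lit ✓`cubeLamBP'_hclass`), `hIn` (✓`cubeLamB_top_subset_cubeLamBP'`), (1.34)∕axial (✓`h34_of_inAk_univ`,
✓`hAx_of_inAx_one`), (1.35) under the γ law from J3 (d) `htw` (ym-ust-19200-w3 g9's ✓`HalvingHSiteTopRowsOfSocketsGamma.h135_cubeMember_γ`).  HONEST SCOPE: one `exact`; the
windows, `htw`, `hreads`, `htop`, `H42cross` stay the caller's; nothing of Prop. 3∕4 or Theorem 4 is proved in this file.

References: T. Bałaban, CMP **99** (1985) 75–102 [Balaban1985RegularSpaces] ((1.42) p.83, (1.35) p.82, (1.29) p.81, (1.31) p.82, Prop. 3 p.87, (1.131) p.99); CMP **96** (1984) 223–250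
[Balaban1984PropagatorsII] ((2.3) p.224); CMP **98** (1985) 17–51 [Balaban1985Averaging] (Prop. 4 pp.38–39, (97)–(100) p.32); CMP **102** (1985) 277–309 [Balaban1985Variational] ((152)–(156) pp.301–302).
-/

set_option autoImplicit false

noncomputable section

open scoped BigOperators Matrix.Norms.L2Operator
open NormedSpace
open Complex (I)

namespace Summit.QuantumFields.YangMills.Theorems.HalvingHSiteTopH42OfTowerGamma

open Literature.MathematicalPhysics.QuantumFieldTheory.Balaban1983to89
open T4Continuum
open Literature.MathematicalPhysics.QuantumFieldTheory.Balaban1983to89.T3ContinuumYM3Torus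
open MatrixLog (mlog)
open B5Eq118OneStroke (iterBlockOf)
open B7Prop1Explicit renaming Site → LSite
open B7Prop1Explicit (e)
open B7Prop2Explicit (unitaryUnits C0 c2' avgIter)
open B7Prop3Flat (c3)
open B7Prop4Flat (C2 c4)
open B7Prop1Local (InBox loK bondHiK)
open B7Eq92Concrete (mgauge)
open B8Ineq130 (tlo thi)
open B8Ineq132 (InAk)
open B8Eq119TwistedAxial (Restr129 InAx)
open B8Eq131Cubes (cube gs tLo tHi)
open B8Eq131CubesAdmissible (cubeFam)
open B8CubeMemberZd (cubeLamS cubeLamB hΩ_cubeFam)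
open B9SupplySockB9P3ZdGamma (cubeLamBP')
open B8CubeMemberLamBPrimeLaws (cubeLamBP'_hbox_pred cubeLamBP'_hclass)
open B8Eq184Proof (gaugeExp cfgExp)
open B8Eq140Level (SideTouches)
open B8Eq146AExpansion (iEta)
open B8Eq138LandauZd (IsLandau138W)
open B7Prop4GeneralLevels (logCovIter)
open B10Eq27TorusAxialLog (rel pull unitsField toUField suIncl gaugeActT)
open B15Eq112TorusCover (lift cover)
open Node00 (coverAt)
open Summit.QuantumFields.YangMills.Theorems.Prop8ChartDoubleBar (dbarIterU)
open Summit.QuantumFields.YangMills.Theorems (FlatMinimizerH.le_T3)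
open HalvingP1FlatCoreSupplierInduction (h34_of_inAk_univ hAx_of_inAx_one)
open HalvingHSiteTopRowsOfSocketsGamma (h135_cubeMember_γ)
open P1FlatCoreTopH42Gamma (H42_top_guarded_γ cubeLamB_top_subset_cubeLamBP')

variable (F : T3Family) {n K : ℕ}

/-- ★★★ **THE RESHAPED `H42` SOCKET's INHABITANT, EDITION γ** — ✓`H42_of_towerTop` (p666867) with: [3] Prop. 4's five windows in the γ shape (at `L²ε₀`, `L·α₂`),
the conclusion on PRINT's split class `cubeLamBP′ … (K − n) (K − n) j` (T4γ's `Λb`), and ONE new displayed antecedent after `htop`: the ∀(u, V′, A′)-closed residual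
`H42cross` of ✓`P1FlatCoreTopH42Gamma.H42_top_guarded_γ` at the member (`Λb k := cubeLamBP′ …`, `ΛbIn := cubeLamB …`, the knit `Lan` at `(U♯)^{g′}`) = (1.42) on the level-`k`
COLLAR bonds (LEAD-H WORD 25's `H42topCrossL` before its ∀gJ-closure).  Inside: member geometry by lit ✓`hΩ_cubeFam`, ✓`cubeLamBP'_hbox_pred` (γ box law), ✓`cubeLamBP'_hclass`
(`j < k`), `hIn` ✓`cubeLamB_top_subset_cubeLamBP'`; (1.34)∕axial by ✓`h34_of_inAk_univ`∕✓`hAx_of_inAx_one`; (1.35) under the γ law by ✓`h135_cubeMember_γ` (J3 (d)).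
[cite: Balaban1985RegularSpaces, (1.42) p.83, Prop. 3 p.87, (1.35) p.82, (1.29) p.81, (1.31) p.82, (1.131) p.99; Balaban1984PropagatorsII, (2.3) p.224; Balaban1985Averaging, Prop. 4 pp.38-39, (97)-(100) p.32; Balaban1985Variational, (152)-(156) pp.301-302] -/
theorem H42_of_towerTop_γ (hnK : n < K) {a : LSite (F.P K).d} {M' ρ' : ℕ} (hρ' : (F.P K).L ≤ ρ')
    (U : GaugeField (F.P K) 0 (Matrix.specialUnitaryGroup (Fin 2) ℂ))
    {ε₀ α₁ cstar α₄ : ℝ} (hε₀ : 0 < ε₀) (hα₁ : 0 < α₁) (hα₂ : 0 ≤ 2 * ((F.P K).L * cstar) + 8 * α₄)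
    -- [3] Prop. 4's windows ONE LEVEL LOWER (edition γ): at `(L²ε₀, L·α₂)`, `α₂ := 2(L·c⋆) + 8α₄`
    (hα3 : C0 (F.P K).d * (((F.P K).L : ℝ) ^ 2 * ε₀) ≤ 1 / 3) (hα4 : 4 * (((F.P K).L : ℝ) ^ 2 * ε₀) ≤ c2' (F.P K).d (F.P K).L)
    (h16 : 16 * (((F.P K).L : ℝ) * (2 * ((F.P K).L * cstar) + 8 * α₄)) ≤ 1)
    (hsmallP : Real.exp (4 * (800 * (((F.P K).d : ℝ) + 1) ^ 2 * (((F.P K).d : ℝ) + 4)) * (((F.P K).L : ℝ) ^ 2 * ε₀))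
      * (1 + 8 * (131072 * (((F.P K).d : ℝ) + 1) ^ 2) * (((F.P K).L : ℝ) * (2 * ((F.P K).L * cstar) + 8 * α₄))) ≤ 2)
    (hc₃P : 2 * (((F.P K).L : ℝ) * (2 * ((F.P K).L * cstar) + 8 * α₄)) ≤ c3 (F.P K).d (F.P K).L) (hsmall₁ : ((F.P K).d : ℝ) * (F.P K).L * α₁ ≤ 1 / 8)
    -- the knit windows, the read radius, the top budget and the (1.42) window (numeric; the window hand's)
    (hkb : 2 * ((F.P K).L * cstar) + 8 * α₄ ≤ c4 (F.P K).d)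
    (hbudget : 243200 * ((((F.P K).d + 2) * (F.P K).L : ℕ) : ℝ) ^ 2 * (2 * ((F.P K).L * cstar) + 8 * α₄) ≤ 1)
    {r t : ℝ} (hr : r ≤ 1 / 2) (hr2 : 2 * r ≤ (2 * ((F.P K).L * cstar) + 8 * α₄) * (((F.P K).L : ℝ) ^ (K - n))⁻¹)
    (hwin : t + (C2 (F.P K).d + 64 * 60800 * ((((F.P K).d + 2) * (F.P K).L : ℕ) : ℝ) ^ 2) * (2 * ((F.P K).L * cstar) + 8 * α₄) ^ 2 <
      2 * ((F.P K).d : ℝ) * (F.P K).L * α₁) :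
    -- THE DISPLAYED `H42` TEXT (✓`HalvingHSiteRowsOfSockets.siteRows_of_sockets` :193) WITH `htw`, `hreads`, `htop` INSERTED
    ∀ (gJ : GaugeTransf (F.P K) 0 (Matrix.specialUnitaryGroup (Fin 2) ℂ)),
      InAk (F.P K).L (K - n) (((F.L : ℝ)⁻¹) ^ (K - n)) ε₀ (fun _ => (Set.univ : Set (LSite (F.P K).d))) (pull (unitsField (toUField (GaugeField.gaugeAct gJ U))) 0) →
      (∀ m', m' ≤ K - n → ∀ Λ : ℕ → Set (LSite (F.P K).d), InAx (F.P K).L m' Λ (1 : LSite (F.P K).d → Fin (F.P K).d → (Matrix (Fin 2) (Fin 2) ℂ)ˣ) (pull (unitsField (toUField (GaugeField.gaugeAct gJ U))) 0)) →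
      -- NEW: J3 (d) — the pre-gauged field's averages near `1` at every depth on the tilde-cube's tower
      (∀ m', m' ≤ K - n → ∀ (x : LSite (F.P K).d) (ν : Fin (F.P K).d), tlo (F.P K).L (tLo a ρ') m' ≤ x → x + e ν ≤ thi (F.P K).L (tHi a M' ρ') m' →
        ‖((avgIter (F.P K).L (pull (unitsField (toUField (GaugeField.gaugeAct gJ U))) 0) (K - n - m') x ν : (Matrix (Fin 2) (Fin 2) ℂ)ˣ) :
            Matrix (Fin 2) (Fin 2) ℂ) - 1‖ < α₁) →
      ∀ (g' : GaugeTransf (F.P K) 0 (Matrix (Fin 2) (Fin 2) ℂ)ˣ),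
      -- NEW: the reads of `(U♯)^{g′}` on the top constraint bonds are within `r` of `1`
      (∀ c ∈ (cubeLamB (F.P K).L a M' ρ' (K - n) (K - n)) (K - n), ∀ b : PBond (F.P K) 0,
        (iterBlockOf (K - n) b.src = (⟨coverAt (F.P K) (K - n) c.1, c.2⟩ : PBond (F.P K) (K - n)).src ∨
          iterBlockOf (K - n) b.src = (⟨coverAt (F.P K) (K - n) c.1, c.2⟩ : PBond (F.P K) (K - n)).tgt) →
        (iterBlockOf (K - n) b.tgt = (⟨coverAt (F.P K) (K - n) c.1, c.2⟩ : PBond (F.P K) (K - n)).src ∨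
          iterBlockOf (K - n) b.tgt = (⟨coverAt (F.P K) (K - n) c.1, c.2⟩ : PBond (F.P K) (K - n)).tgt) →
        ‖((gaugeActT g' (unitsField (toUField U)) b : (Matrix (Fin 2) (Fin 2) ℂ)ˣ) : Matrix (Fin 2) (Fin 2) ℂ) - 1‖ ≤ r) →
      -- NEW: the top double-bar logarithms of `(U♯)^{g′}` on the top constraint bonds are `≤ t`
      (∀ c ∈ (cubeLamB (F.P K).L a M' ρ' (K - n) (K - n)) (K - n),
        ‖mlog ((dbarIterU (K - n) (gaugeActT g' (unitsField (toUField U))) ⟨coverAt (F.P K) (K - n) c.1, c.2⟩ : (Matrix (Fin 2) (Fin 2) ℂ)ˣ) :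
          Matrix (Fin 2) (Fin 2) ℂ)‖ ≤ t) →
      -- NEW (edition γ): the ∀(u, V′, A′)-closed RESIDUAL — (1.42) on the level-`k` COLLAR bonds `cubeLamBP′ … k k k ∖ cubeLamB … k k k` (LEAD-H WORD 25 `H42topCrossL`)
      (∀ (u : LSite (F.P K).d → (Matrix (Fin 2) (Fin 2) ℂ)ˣ) (V' : LSite (F.P K).d → Fin (F.P K).d → (Matrix (Fin 2) (Fin 2) ℂ)ˣ)
        (A' : LSite (F.P K).d → Fin (F.P K).d → (Matrix (Fin 2) (Fin 2) ℂ)),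
        (∀ x, u x ∈ unitaryUnits (Matrix (Fin 2) (Fin 2) ℂ)) → mgauge (1 : LSite (F.P K).d → Fin (F.P K).d → (Matrix (Fin 2) (Fin 2) ℂ)ˣ) u V' = (pull (unitsField (toUField (GaugeField.gaugeAct gJ U))) 0) →
        Restr129 (F.P K).L (K - n) (Function.update (cubeLamS (F.P K).L a M' ρ' (K - n) (K - n)) (K - n) ∅) (1 : LSite (F.P K).d → Fin (F.P K).d → (Matrix (Fin 2) (Fin 2) ℂ)ˣ) u →
        (IsLandau138W (F.P K).L (K - n) (((F.L : ℝ)⁻¹) ^ (K - n)) ((cubeFam false (F.P K).L a M' ρ' (K - n)) 0) (cubeLamS (F.P K).L a M' ρ' (K - n) (K - n)) (1 : LSite (F.P K).d → Fin (F.P K).d → (Matrix (Fin 2) (Fin 2) ℂ)ˣ) V' ∧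
          (∀ c ∈ (cubeLamB (F.P K).L a M' ρ' (K - n) (K - n)) (K - n), ∀ (y : LSite (F.P K).d) (τ : Fin (F.P K).d),
            InBox (loK (F.P K).L (K - n) c.1) (bondHiK (F.P K).L (K - n) c.1 c.2) y → InBox (loK (F.P K).L (K - n) c.1) (bondHiK (F.P K).L (K - n) c.1 c.2) (y + e τ) →
            V' y τ = gaugeActT g' (unitsField (toUField U)) ⟨cover (F.P K) y, τ⟩)) →
        (∀ y τ, IsSelfAdjoint (A' y τ)) →
        (∀ j, j ≤ K - n → ∀ y τ, SideTouches ((cubeFam false (F.P K).L a M' ρ' (K - n)) j) y τ →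
          V' y τ = cfgExp (((F.L : ℝ)⁻¹) ^ (K - n)) A' y τ ∧ ‖A' y τ‖ ≤ (2 * ((F.P K).L * cstar) + 8 * α₄) * (((F.P K).L : ℝ) ^ j * (((F.L : ℝ)⁻¹) ^ (K - n)))⁻¹) →
        (∀ y τ, (∀ j, j ≤ K - n → ¬ SideTouches ((cubeFam false (F.P K).L a M' ρ' (K - n)) j) y τ) → A' y τ = 0) →
        ∀ c ∈ (cubeLamBP' (F.P K).L a M' ρ' (K - n) (K - n)) (K - n), c ∉ (cubeLamB (F.P K).L a M' ρ' (K - n) (K - n)) (K - n) →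
          ‖logCovIter (F.P K).L (1 : LSite (F.P K).d → Fin (F.P K).d → (Matrix (Fin 2) (Fin 2) ℂ)ˣ) (iEta (((F.L : ℝ)⁻¹) ^ (K - n)) A') (K - n) c.1 c.2‖ < 2 * (F.P K).d * (F.P K).L * α₁) →
      ∀ (u : LSite (F.P K).d → (Matrix (Fin 2) (Fin 2) ℂ)ˣ) (V' : LSite (F.P K).d → Fin (F.P K).d → (Matrix (Fin 2) (Fin 2) ℂ)ˣ)
        (A' : LSite (F.P K).d → Fin (F.P K).d → (Matrix (Fin 2) (Fin 2) ℂ)),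
      (∀ x, u x ∈ unitaryUnits (Matrix (Fin 2) (Fin 2) ℂ)) → mgauge (1 : LSite (F.P K).d → Fin (F.P K).d → (Matrix (Fin 2) (Fin 2) ℂ)ˣ) u V' = (pull (unitsField (toUField (GaugeField.gaugeAct gJ U))) 0) →
      Restr129 (F.P K).L (K - n) (Function.update (cubeLamS (F.P K).L a M' ρ' (K - n) (K - n)) (K - n) ∅) (1 : LSite (F.P K).d → Fin (F.P K).d → (Matrix (Fin 2) (Fin 2) ℂ)ˣ) u →
      (IsLandau138W (F.P K).L (K - n) (((F.L : ℝ)⁻¹) ^ (K - n)) ((cubeFam false (F.P K).L a M' ρ' (K - n)) 0) (cubeLamS (F.P K).L a M' ρ' (K - n) (K - n)) (1 : LSite (F.P K).d → Fin (F.P K).d → (Matrix (Fin 2) (Fin 2) ℂ)ˣ) V' ∧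
        (∀ c ∈ (cubeLamB (F.P K).L a M' ρ' (K - n) (K - n)) (K - n), ∀ (y : LSite (F.P K).d) (τ : Fin (F.P K).d),
          InBox (loK (F.P K).L (K - n) c.1) (bondHiK (F.P K).L (K - n) c.1 c.2) y → InBox (loK (F.P K).L (K - n) c.1) (bondHiK (F.P K).L (K - n) c.1 c.2) (y + e τ) →
          V' y τ = gaugeActT g' (unitsField (toUField U)) ⟨cover (F.P K) y, τ⟩)) →
      (∀ y τ, IsSelfAdjoint (A' y τ)) →
      (∀ j, j ≤ K - n → ∀ y τ, SideTouches ((cubeFam false (F.P K).L a M' ρ' (K - n)) j) y τ →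
        V' y τ = cfgExp (((F.L : ℝ)⁻¹) ^ (K - n)) A' y τ ∧ ‖A' y τ‖ ≤ (2 * ((F.P K).L * cstar) + 8 * α₄) * (((F.P K).L : ℝ) ^ j * (((F.L : ℝ)⁻¹) ^ (K - n)))⁻¹) →
      (∀ y τ, (∀ j, j ≤ K - n → ¬ SideTouches ((cubeFam false (F.P K).L a M' ρ' (K - n)) j) y τ) → A' y τ = 0) →
      ∀ j, j ≤ K - n → ∀ c ∈ (cubeLamBP' (F.P K).L a M' ρ' (K - n) (K - n)) j, ‖logCovIter (F.P K).L (1 : LSite (F.P K).d → Fin (F.P K).d → (Matrix (Fin 2) (Fin 2) ℂ)ˣ) (iEta (((F.L : ℝ)⁻¹) ^ (K - n)) A') j c.1 c.2‖ < 2 * (F.P K).d * (F.P K).L * α₁ := by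
  intro gJ hInAk hInAx htw g' hreads htop hcross u V' A' hu hmg h129 hLan hsa hsock hA0
  letI : CStarAlgebra (Matrix (Fin 2) (Fin 2) ℂ) := {}
  have hd2 : 2 ≤ (F.P K).d := by rw [T3Family.P_d]; norm_num
  have hL2 : 2 ≤ (F.P K).L := by have := F.hL.2; exact this
  have hL1 : 1 ≤ (F.P K).L := (F.P K).L_pos
  have hρ'1 : 1 ≤ ρ' := hL1.trans hρ'
  have hk1 : 1 ≤ K - n := by omega
  have hk : K - n ≤ (F.P K).m + (F.P K).K := FlatMinimizerH.le_T3 F n K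
  have hL0 : (0 : ℝ) < (F.L : ℝ) := by have := F.hL.2; exact_mod_cast (by omega : 0 < F.L)
  have hη : (0 : ℝ) < ((F.L : ℝ)⁻¹) ^ (K - n) := pow_pos (inv_pos.2 hL0) _
  -- the member geometry (lit `B8CubeMemberZd`)
  have hΩ := hΩ_cubeFam (d := (F.P K).d) hL1 a M' hρ' (K - n)
  have hbox := cubeLamBP'_hbox_pred (d := (F.P K).d) hL1 a M' hρ' (K - n) (K - n) le_rfl
  have hclass := cubeLamBP'_hclass (d := (F.P K).d) hL1 a M' hρ' (K - n) (K - n) le_rfl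
  -- (1.34), the axial class and (1.35) of the pre-gauged field from J3's currency
  have h34 := h34_of_inAk_univ hInAk (cubeFam false (F.P K).L a M' ρ' (K - n))
  have hAx := hAx_of_inAx_one hInAx (fun _ => Function.update (cubeLamS (F.P K).L a M' ρ' (K - n) (K - n)) (K - n) ∅) (K - n) le_rfl
  have h135c := h135_cubeMember_γ (P := F.P K) (𝔸 := Matrix (Fin 2) (Fin 2) ℂ) hL2 a M' hρ'1 htw
  have h135 : ∀ j, j ≤ K - n → ∀ (z : LSite (F.P K).d) (μ : Fin (F.P K).d),
      (∀ x, InBox (loK (F.P K).L j z) (bondHiK (F.P K).L j z μ) x → x ∈ cubeFam false (F.P K).L a M' ρ' (K - n) (j - 1)) →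
      ‖((avgIter (F.P K).L (B8Lemma1NonAbelian.mulCfg (pull (unitsField (toUField (GaugeField.gaugeAct gJ U))) 0)
          (1 : LSite (F.P K).d → Fin (F.P K).d → (Matrix (Fin 2) (Fin 2) ℂ)ˣ)) j z μ : (Matrix (Fin 2) (Fin 2) ℂ)ˣ) : Matrix (Fin 2) (Fin 2) ℂ) - 1‖ ≤ α₁ := by
    intro j hj z μ hb
    have h := h135c j hj z μ hb
    rwa [B8Ineq132.avgIter_one, Pi.one_apply, Pi.one_apply, Units.val_one] at h
  -- THE CALL
  exact H42_top_guarded_γ (n := Fin 2) hd2 hL2 hk1 hk hη hε₀ hα₁ hα₂ hα3 hα4 h16 hsmallP hc₃P hsmall₁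
    (cubeFam false (F.P K).L a M' ρ' (K - n)) hΩ (cubeLamS (F.P K).L a M' ρ' (K - n) (K - n)) (cubeLamBP' (F.P K).L a M' ρ' (K - n) (K - n))
    hbox (fun j hj => hclass j hj.le) h34 hAx h135
    (fun _ W => IsLandau138W (F.P K).L (K - n) (((F.L : ℝ)⁻¹) ^ (K - n)) ((cubeFam false (F.P K).L a M' ρ' (K - n)) 0)
        (cubeLamS (F.P K).L a M' ρ' (K - n) (K - n)) (1 : LSite (F.P K).d → Fin (F.P K).d → (Matrix (Fin 2) (Fin 2) ℂ)ˣ) W ∧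
      (∀ c ∈ (cubeLamB (F.P K).L a M' ρ' (K - n) (K - n)) (K - n), ∀ (y : LSite (F.P K).d) (τ : Fin (F.P K).d),
        InBox (loK (F.P K).L (K - n) c.1) (bondHiK (F.P K).L (K - n) c.1 c.2) y → InBox (loK (F.P K).L (K - n) c.1) (bondHiK (F.P K).L (K - n) c.1 c.2) (y + e τ) →
        W y τ = gaugeActT g' (unitsField (toUField U)) ⟨cover (F.P K) y, τ⟩))
    (gaugeActT g' (unitsField (toUField U))) (cubeLamB (F.P K).L a M' ρ' (K - n) (K - n) (K - n)) (cubeLamB_top_subset_cubeLamBP' hL1 a M' ρ' hk1)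
    (fun W h => h.2) hr hr2 hreads hkb hbudget htop hwin hcross
    u V' A' hu hmg h129 hLan hsa hsock hA0

end Summit.QuantumFields.YangMills.Theorems.HalvingHSiteTopH42OfTowerGamma

end
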